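import Summits.BirchSwinnertonDyer.BirchSwinnertonDyer.Theorems.ClassRecordThreeShimuraKolyvaginImageInputs
import HarnessLib

/-!
# The four IMAGE INPUTS of the Kolyvagin ORDER machine at `p = 3` when `3` is INERT in `K`
# (crux `CornerAtThree`, item stmt-BirchSwinnertonDyer-19111, conjunct 3 along the CARRIER-INERT Shimura road;
# cell `bsd-stepL`, seat `bsd-stepL-corner3-p2` g5 = WIDTH-LEVER lane B; `--supports … --as helper`)

HONEST FRAMING: THEOREMS ONLY (no definition, no named fact, no `sorry`); nothing here is a BSD class theorem;
no census label moves (T7); item 19111 is NOT closed. BSD is not proved by any of this.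

## What this file does

Seat shim3b g4's `ShimuraKolyvaginImageInputs.kolyvaginImageInputs_three` delivers the image inputs of the
tree's Kolyvagin machine at `p = 3` — (hz) some `z ∈ Γ_K` acts as `−1` on `E(K̄)[3]`, (hS) `E(K̄)[3]` is a
simple `Γ_K`-module, (hCe) its `Γ_K`-commutant is scalar, (hbot) `E(K)[3] = 0` — from `E[3]` IRREDUCIBLE alone
(surjective or not), on the locus of crux 19616 where `3` SPLITS in `K` (its binder `h3`). Along lane B's
carrier-inert road for the (T4″)₃ corner (`Lines/inert.lean`, registered 2026-08-27 RULING 35; typed object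
`Theorems.CornerAtThreeShimuraInertDisplay`) the prime `3` lies in the inert set `S` (`3 ∣ N⁻`), so `h3` fails;
but the ONLY use of `h3` in that proof is `3 ∤ d_K` (to keep Gross's disjointness prime `q ∣ d_K` away from
`3`), which the inert clause `hin` hands over directly (`¬ (3 : ℤ) ∣ d_K` is its last conjunct at `ℓ = 3`).

* `kolyvaginImageInputs_three_of_not_dvd_discr` — the four inputs, at the BASE level `3` (the shape consumed
  by shim3b's `…_of_image` leaves: `exists_kolyvaginPrime_gt_pow_kernel_of_image`, `McCallum1991_cor_3_2_pow_of_image`,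
  `ShimuraKolyvaginFixedOfTorsion.*_of_torsionBy_eq_bot`), from `Irr W 3`, `K` imaginary quadratic, the
  crux's `hin` ∕ `hsp` clauses VERBATIM and `¬ (3 : ℤ) ∣ d_K` (proof = shim3b's, `h3` replaced).
* `kolyvaginImageInputs_three_of_mem_inertSet` — the same on the inert road's locus `3 ∈ S`.
* `kolyvaginImageInputs_three_pow_of_not_dvd_discr` — the level-`3^M` forms (hz on `E[3^M]`, `E(K)[3^M] = 0`).

No Kolyvagin class, no order bound, nothing about `X_{N⁺,N⁻}` is claimed here.
References: [GrossLMS1991] §9 (PDF p. 227; Props. 9.1, 9.3); [McCallumLMS1991] §3; [Cha2005] Lemmas 22–23.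
presearch: image inputs at 3 for irreducible non-surjective image → tree only (shim3b p484489 ∕ p477584); print
nearest = Gross 1991 §9 under surjectivity [corpus: book:editornd-l-functions-arithmetic p. 227]; galaxy
«normalizer of a Cartan|Kolyvagin prime» → 0 relevant (shim3b g5 §1).
-/

set_option autoImplicit false
set_option linter.dupNamespace false

noncomputable section

open scoped Classical

open Field WeierstrassCurve NumberField IsDedekindDomain
  Literature.NumberTheory.EllipticCurves Literature.NumberTheory.GaloisRepresentations
  Literature.NumberTheory.EllipticCurves.Rank1Residual

universe u

namespace Summit.BirchSwinnertonDyer.BirchSwinnertonDyer.Theorems.ShimuraKolyvaginOfImage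

open Summit.BirchSwinnertonDyer.BirchSwinnertonDyer.Theorems.ShimuraKolyvaginImageDisjoint
  Summit.BirchSwinnertonDyer.BirchSwinnertonDyer.Theorems.ShimuraKolyvaginImageInputs

variable (K : Type u) [Field K] [NumberField K] (W : WeierstrassCurve ℚ) [W.IsElliptic]

/-- **The four image inputs of the Kolyvagin machine at `p = 3`, base level, from `Irr W 3` and `3 ∤ d_K`.**
For `E = W/ℚ` of conductor `N` with `E[3]` irreducible, `K` imaginary quadratic, an inert set `S` of primes of
`N` none dividing `d_K`, every other prime of `N` split in `K`, and `3 ∤ d_K`: (hz) some `z ∈ Γ_K` acts as `−1`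
on `E(K̄)[3]`; (hS) `E(K̄)[3]` is a simple `Γ_K`-module; (hCe) every `Γ_K`-equivariant endomorphism of
`E(K̄)[3]` is a homothety; (hbot) `E(K)[3] = 0`. Shim3b g4's `kolyvaginImageInputs_three` with its binder
«`3` split in `K`» replaced by what its proof uses, `3 ∤ d_K` (Gross's disjointness prime `q ∣ d_K`, `q ∤ 3N`).
[cite: GrossLMS1991, §9 (PDF p. 227, before Prop. 9.1) and Prop. 9.3] [cite: Cha2005, Lemmas 22–23] -/
theorem kolyvaginImageInputs_three_of_not_dvd_discr [Fact (Nat.Prime 3)] {N : ℕ} (S : Finset ℕ)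
    (hN : W.conductorNorm ℤ = N) (hirr : W.HasIrreducibleModPGaloisRep 3)
    (hK : IsImaginaryQuadratic K)
    (hS : ∀ ℓ ∈ S, ℓ.Prime ∧ ℓ ∣ N ∧ ¬ ℓ ^ 2 ∣ N ∧
      ((Ideal.span {(ℓ : ℤ)}).primesOver (𝓞 K)).ncard = 1 ∧ ¬ (ℓ : ℤ) ∣ NumberField.discr K)
    (hsplit : ∀ ℓ : ℕ, ℓ.Prime → ℓ ∣ N → ℓ ∉ S →
      ((Ideal.span {(ℓ : ℤ)}).primesOver (𝓞 K)).ncard = 2)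
    (h3 : ¬ ((3 : ℕ) : ℤ) ∣ NumberField.discr K) :
    (∃ z : absoluteGaloisGroup K,
        ∀ Q : geomTorsion (W.baseChange K) ((3 : ℕ) : ℤ), z • Q = -Q) ∧
      (W.baseChange K).HasIrreducibleModPGaloisRep 3 ∧
      (∀ f : geomTorsion (W.baseChange K) ((3 : ℕ) : ℤ) →+ geomTorsion (W.baseChange K) ((3 : ℕ) : ℤ),
        (∀ (g : absoluteGaloisGroup K) (t : geomTorsion (W.baseChange K) ((3 : ℕ) : ℤ)),
          f (g • t) = g • f t) → ∃ k : ℤ, ∀ t, f t = k • t) ∧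
      AddSubgroup.torsionBy (W.baseChange K).toAffine.Point ((3 : ℕ) : ℤ) = ⊥ := by
  -- a prime `q ∣ d_K` with `q ∤ N`, `q ≠ 3`
  obtain ⟨q, hq, hqd, hqN⟩ :=
    exists_prime_dvd_discr_not_dvd K hK.1 S (fun ℓ hℓ ↦ (hS ℓ hℓ).2.2.2.2) hsplit
  have hqN' : ¬ q ∣ W.conductorNorm ℤ := by rwa [hN]
  have hq3 : q ≠ 3 := by
    rintro rfl
    exact h3 hqd
  have hq31 : ¬ (q : ℤ) ∣ ((3 : ℕ) : ℤ) := fun h ↦ by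
    have h' : q ∣ 3 := by exact_mod_cast h
    exact hq3 ((Nat.prime_dvd_prime_iff_eq hq Nat.prime_three).mp h')
  refine ⟨?_, ?_, ?_, ?_⟩
  · exact ShimuraKolyvaginImageOverK.exists_smul_eq_neg_three_of_irr_of_finrank_eq_two W K hK.1 hirr
  · exact hasIrreducibleModPGaloisRep_baseChange W K hK.1 hq hqd hqN' hq31 hirr
  · exact fun f hf ↦ exists_eq_zsmul_baseChange_of_irr W K hK.1 hq hqd hqN' (by decide) hq31 hirr f hf
  · exact ShimuraKolyvaginImageOverK.torsionBy_three_eq_bot_of_irr_of_isImaginaryQuadratic W K hK hirr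

/-- **The four image inputs at `p = 3` on the CARRIER-INERT road (`3 ∈ S`).** As
`kolyvaginImageInputs_three_of_not_dvd_discr`, the side condition `3 ∤ d_K` being the last conjunct of the inert
clause at `ℓ = 3 ∈ S` — the locus of lane B's typed object `Theorems.CornerAtThreeShimuraInertDisplay`
(item 19111, `Lines/inert.lean`). [cite: GrossLMS1991, §9 (PDF p. 227) and Prop. 9.3] -/
theorem kolyvaginImageInputs_three_of_mem_inertSet [Fact (Nat.Prime 3)] {N : ℕ} (S : Finset ℕ)
    (hN : W.conductorNorm ℤ = N) (hirr : W.HasIrreducibleModPGaloisRep 3)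
    (hK : IsImaginaryQuadratic K)
    (hS : ∀ ℓ ∈ S, ℓ.Prime ∧ ℓ ∣ N ∧ ¬ ℓ ^ 2 ∣ N ∧
      ((Ideal.span {(ℓ : ℤ)}).primesOver (𝓞 K)).ncard = 1 ∧ ¬ (ℓ : ℤ) ∣ NumberField.discr K)
    (hsplit : ∀ ℓ : ℕ, ℓ.Prime → ℓ ∣ N → ℓ ∉ S →
      ((Ideal.span {(ℓ : ℤ)}).primesOver (𝓞 K)).ncard = 2)
    (h3S : 3 ∈ S) :
    (∃ z : absoluteGaloisGroup K,
        ∀ Q : geomTorsion (W.baseChange K) ((3 : ℕ) : ℤ), z • Q = -Q) ∧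
      (W.baseChange K).HasIrreducibleModPGaloisRep 3 ∧
      (∀ f : geomTorsion (W.baseChange K) ((3 : ℕ) : ℤ) →+ geomTorsion (W.baseChange K) ((3 : ℕ) : ℤ),
        (∀ (g : absoluteGaloisGroup K) (t : geomTorsion (W.baseChange K) ((3 : ℕ) : ℤ)),
          f (g • t) = g • f t) → ∃ k : ℤ, ∀ t, f t = k • t) ∧
      AddSubgroup.torsionBy (W.baseChange K).toAffine.Point ((3 : ℕ) : ℤ) = ⊥ :=
  kolyvaginImageInputs_three_of_not_dvd_discr K W S hN hirr hK hS hsplit (hS 3 h3S).2.2.2.2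

/-- **Level-`3^M` forms of (hz) and (hbot) from `Irr W 3` alone** (`K` imaginary quadratic, `M ≥ 1`): some
`z ∈ Γ_K` acts as `−1` on `E(K̄)[3^M]`, and `E(K)[3^M] = 0` — shim3b g3's theorems, re-exported in the
package shape next to the base-level inputs (no disjointness prime needed for these two).
[cite: GrossLMS1991, §2 (after (2.2)) and §9] -/
theorem kolyvaginImageInputs_three_pow_of_irr [Fact (Nat.Prime 3)]
    (hirr : W.HasIrreducibleModPGaloisRep 3) (hK : IsImaginaryQuadratic K) {M : ℕ} (hM : 1 ≤ M) :
    (∃ z : absoluteGaloisGroup K,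
        ∀ Q : geomTorsion (W.baseChange K) ((3 ^ M : ℕ) : ℤ), z • Q = -Q) ∧
      AddSubgroup.torsionBy (W.baseChange K).toAffine.Point ((3 ^ M : ℕ) : ℤ) = ⊥ :=
  ⟨ShimuraKolyvaginImageOverK.exists_smul_eq_neg_three_pow_of_irr_of_isImaginaryQuadratic W K hK hirr hM,
    ShimuraKolyvaginImageOverK.torsionBy_three_pow_eq_bot_of_irr W K hK.1 hirr hM⟩

end Summit.BirchSwinnertonDyer.BirchSwinnertonDyer.Theorems.ShimuraKolyvaginOfImage

end
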